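import Summits.BirchSwinnertonDyer.Rank1Residual.Additive.XGordRankZeroCyclotomicPrimeFacts
import Literature.NumberTheory.EllipticCurves.Rank1Residual.Typed.CasselsLowerBound
import HarnessLib

/-!
# Line V19: the typed UPPER HALF for the additive curve and the Cassels–Tate squeeze on the
# `p ∣ #Ш_an(W)` rows (cell `b2b-bsdres`, seat additive-p4)

HONEST FRAMING (cell `b2b-bsdres`, run/shared/lean/b2b/bsd-rank1-residual/, verbatim in every
file): the goal of the cell is to DELETE the COMBINATION-SHAPED residual classes of the
Birch–Swinnerton-Dyer formula for ALL analytic-rank `≤ 1` elliptic curves over `ℚ` — "full BSD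
formula for every rank `≤ 1` curve in class `C`" assembled STRICTLY from published theorems — so
that the rank-`≤ 1` remainder becomes exactly the CONSTRUCTION-SHAPED classes, which are TYPED
(missing-input `Prop`s), NOT attempted. This is not "finishing BSD". Seat additive-p4 (research route
on X3/X4); the labels of X3 and X4 are UNCHANGED by this file; nothing is booked here.

Theorems only (no `def`, no `sorry`, no named fact). The core inequality of line V19 bounds
`ord_p#Ш(V) + ord_p#Ш(W)`; when the twist pair has `p ∤ #Ш_an(V)` and the numerical certificate of
`…bsdp_of_certificate_of_facts` holds, it yields `ord_p#Ш(W) ≤ ord_p#Ш_an(W)` — the cell's typed UPPER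
half `Typed.MissingUpperBoundAt W p` — even when `p ∣ #Ш_an(W)`. Census (V19-CENSUS.tsv): the four X4
CORE rows `2900d1, 10850m1, 16900k1, 19350cb1` at `p = 5` have `#Ш_an(W) = 25` and satisfy the
certificate; with Cassels–Tate (`hCT`, bsd.S18: `#Ш` is a square) ONE finite certificate `Ш(W)[5] ≠ 0`
(i.e. `5 ∣ #Ш(W)`) then gives `BSD(W,5)` (`missingLowerBoundAt_of_casselsTate_of_pow_dvd`), exactly as
in the `p = 3` corollaries `X3CyclotomicThree.bsdp_of_casselsTate_of_pow_dvd_of_facts`.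
-/

noncomputable section

open scoped Classical MatrixGroups ModularForm

open CongruenceSubgroup WeierstrassCurve NumberField IsDedekindDomain
  Literature.NumberTheory.EllipticCurves Literature.NumberTheory.EllipticCurves.ModularForms
  Literature.NumberTheory.EllipticCurves.Rank1Residual
  Literature.NumberTheory.EllipticCurves.Rank1Residual.Typed
  Literature.NumberTheory.GaloisRepresentations

namespace Summit.BirchSwinnertonDyer.Rank1Residual.Additive

section UpperHalf

variable (p : ℕ) [hp : Fact p.Prime]
  (V : WeierstrassCurve ℚ) [V.IsElliptic] [V.IsGloballyMinimal]
  (W : WeierstrassCurve ℚ) [W.IsElliptic] [W.IsGloballyMinimal]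

/-- **X4, the typed UPPER half for the additive curve from the certificate.** In the situation of
`X4GordCyclotomicPrime.exists_padicVal_shaOrder_add_le_of_facts` (X4 ∧ (G-ord, `e = 2`) ∧ ranks `(0,0)`,
`ρ̄_{W,p}` onto, `p ≥ 5`), if `p ∤ #Ш_an(V)` (`ord_p q_V ≤ 0`) and the numerical certificate holds, then
`ord_p #Ш(W) ≤ ord_p #Ш_an(W)`, i.e. `Typed.MissingUpperBoundAt W p`.
[cite: Kato2004Asterisque, Thm. 17.4 (3) (p. 273)] [cite: GreenbergLNM1716, Thm. 4.1 (p. 102)] -/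
theorem X4GordCyclotomicPrime.missingUpperBoundAt_of_certificate_of_facts
    (hK : Kato2004.charIdeal_dvd_padicLFunction_cyclotomicPrime_of_surjective)
    (hGr : Greenberg1999.thm41_charValue_rankZero_numberField)
    (hGZK : rank_eq_analyticRank_of_analyticRank_le_one) (hmod : hasEntireLFunction_rat)
    (hp5 : 5 ≤ p) (C : VariableChange ℚ) (hC : C • V.quadraticTwist ((-1 : ℚ) ^ (p / 2) * p) = W)
    (hord : IsOrdinaryAt V p) (hsurj : Surj W p) (hadd : Addv W p)
    (hrV : V.analyticRank = 0) (hrW : W.analyticRank = 0)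
    {N : ℕ} [NeZero N] {f : CuspForm (Gamma0 N) 2} (hf : IsNewformOf V f)
    (ϖ ϖ' : ℚ) (hϖ : (ϖ : ℝ) * V.realPeriodRat = plusPeriod f)
    (hϖ' : (ϖ' : ℝ) * V.imaginaryPeriodRat = minusPeriod f)
    (hO : (∏ i ∈ ((Finset.range (p - 1)).erase 0).erase (p / 2),
        PowerSeries.constantCoeff
          (if Even i then padicLFunctionBranch f ((unitRoot V p : ℤ_[p]) : ℚ_[p]) i
            else padicLFunctionMinusBranch f ((unitRoot V p : ℤ_[p]) : ℚ_[p]) i)) ≠ 0)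
    (hcert : (padicValNat p V.tamagawaProduct : ℤ) + padicValNat p W.tamagawaProduct +
        2 * padicValNat p (Nat.card (V.baseChange (CyclotomicField p ℚ)).toAffine.Point) +
        ((∏ i ∈ ((Finset.range (p - 1)).erase 0).erase (p / 2),
          PowerSeries.constantCoeff
            (if Even i then padicLFunctionBranch f ((unitRoot V p : ℤ_[p]) : ℚ_[p]) i
              else padicLFunctionMinusBranch f ((unitRoot V p : ℤ_[p]) : ℚ_[p]) i)).valuation +
          ((p / 2 : ℕ) : ℤ) * (padicValRat p ϖ + padicValRat p ϖ') - padicValRat p ϖ -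
          (if p % 4 = 1 then padicValRat p ϖ else padicValRat p ϖ')) ≤
        2 * (padicValNat p (Nat.card V.toAffine.Point) + padicValNat p (Nat.card W.toAffine.Point)) +
          padicValNat p (V.baseChange (CyclotomicField p ℚ)).tamagawaProduct)
    {qV : ℚ} (hqV : shaAn V = (qV : ℂ)) (hvV : padicValRat p qV ≤ 0) :
    MissingUpperBoundAt W p := by
  obtain ⟨qV', qW, hqV', hqW, hle⟩ := X4GordCyclotomicPrime.exists_padicVal_shaOrder_add_le_of_facts
    p V W hK hGr hGZK hmod hp5 C hC hord hsurj hadd hrV hrW hf ϖ ϖ' hϖ hϖ' hO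
  have hqq : qV' = qV := by exact_mod_cast hqV'.symm.trans hqV
  subst hqq
  have hV0 : (0 : ℤ) ≤ padicValNat p V.shaOrder := by positivity
  exact ⟨qW, hqW, by linarith⟩

/-- **X4, `p ∣ #Ш_an(W)` rows: `BSD(W,p)` from the certificate, Cassels–Tate and ONE finite
`p`-descent certificate.** If moreover `#Ш_an(W) = q` with `ord_p q ≤ 2k` and `p^{2k−1} ∣ #Ш(W)`
(for `k = 1`: `Ш(W)[p] ≠ 0`), then `BSD(W,p)`: upper half above, lower half by Cassels–Tate squareness
(`hCT` = bsd.S18). Census: the four X4 CORE rows `2900d1, 10850m1, 16900k1, 19350cb1` (`p = 5`,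
`#Ш_an(W) = 25`, `k = 1`) — each closes with a `5`-descent certificate `5 ∣ #Ш(W)`. Nothing booked.
[cite: Kato2004Asterisque, Thm. 17.4 (3) (p. 273)] [cite: SilvermanAEC2009, Thm. X.4.14]
[cite: Miller2011LMS, §1 and Def. 1.1] -/
theorem X4GordCyclotomicPrime.bsdp_of_casselsTate_of_pow_dvd_of_certificate_of_facts
    (hK : Kato2004.charIdeal_dvd_padicLFunction_cyclotomicPrime_of_surjective)
    (hGr : Greenberg1999.thm41_charValue_rankZero_numberField)
    (hGZK : rank_eq_analyticRank_of_analyticRank_le_one) (hmod : hasEntireLFunction_rat)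
    (hCT : exists_casselsTate_pairing (K := ℚ))
    (hp5 : 5 ≤ p) (C : VariableChange ℚ) (hC : C • V.quadraticTwist ((-1 : ℚ) ^ (p / 2) * p) = W)
    (hord : IsOrdinaryAt V p) (hsurj : Surj W p) (hadd : Addv W p)
    (hrV : V.analyticRank = 0) (hrW : W.analyticRank = 0)
    {N : ℕ} [NeZero N] {f : CuspForm (Gamma0 N) 2} (hf : IsNewformOf V f)
    (ϖ ϖ' : ℚ) (hϖ : (ϖ : ℝ) * V.realPeriodRat = plusPeriod f)
    (hϖ' : (ϖ' : ℝ) * V.imaginaryPeriodRat = minusPeriod f)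
    (hO : (∏ i ∈ ((Finset.range (p - 1)).erase 0).erase (p / 2),
        PowerSeries.constantCoeff
          (if Even i then padicLFunctionBranch f ((unitRoot V p : ℤ_[p]) : ℚ_[p]) i
            else padicLFunctionMinusBranch f ((unitRoot V p : ℤ_[p]) : ℚ_[p]) i)) ≠ 0)
    (hcert : (padicValNat p V.tamagawaProduct : ℤ) + padicValNat p W.tamagawaProduct +
        2 * padicValNat p (Nat.card (V.baseChange (CyclotomicField p ℚ)).toAffine.Point) +
        ((∏ i ∈ ((Finset.range (p - 1)).erase 0).erase (p / 2),
          PowerSeries.constantCoeff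
            (if Even i then padicLFunctionBranch f ((unitRoot V p : ℤ_[p]) : ℚ_[p]) i
              else padicLFunctionMinusBranch f ((unitRoot V p : ℤ_[p]) : ℚ_[p]) i)).valuation +
          ((p / 2 : ℕ) : ℤ) * (padicValRat p ϖ + padicValRat p ϖ') - padicValRat p ϖ -
          (if p % 4 = 1 then padicValRat p ϖ else padicValRat p ϖ')) ≤
        2 * (padicValNat p (Nat.card V.toAffine.Point) + padicValNat p (Nat.card W.toAffine.Point)) +
          padicValNat p (V.baseChange (CyclotomicField p ℚ)).tamagawaProduct)
    {qV : ℚ} (hqV : shaAn V = (qV : ℂ)) (hvV : padicValRat p qV ≤ 0)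
    {q : ℚ} (hq : shaAn W = (q : ℂ)) {k : ℕ} (hv : padicValRat p q ≤ 2 * k)
    (hdvd : p ^ (2 * k - 1) ∣ W.shaOrder) : BSDp W p :=
  bsdp_of_missingPPartAt W p hGZK (by rw [hrW]; exact zero_le_one)
    (missingPPartAt_of_lower_of_upper W p
      (missingLowerBoundAt_of_casselsTate_of_pow_dvd W p hCT (hGZK W (by rw [hrW]; exact zero_le_one)).2
        hq hv hdvd)
      (X4GordCyclotomicPrime.missingUpperBoundAt_of_certificate_of_facts p V W hK hGr hGZK hmod hp5 C hC
        hord hsurj hadd hrV hrW hf ϖ ϖ' hϖ hϖ' hO hcert hqV hvV))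

/-- **X3, the typed UPPER half for the additive curve from the certificate** (`V[p]` reducible,
Wuthrich's all-branches fact): `ord_p #Ш(W) ≤ ord_p #Ш_an(W)` whenever `p ∤ #Ш_an(V)` and the numerical
certificate holds. [cite: Wuthrich2014, Thm. 16 (p. 397)] [cite: GreenbergLNM1716, Thm. 4.1 (p. 102)] -/
theorem X3GordCyclotomicPrime.missingUpperBoundAt_of_certificate_of_facts
    (hW : Wuthrich2014.charIdeal_dvd_padicLFunction_cyclotomicPrime)
    (hGr : Greenberg1999.thm41_charValue_rankZero_numberField)
    (hGZK : rank_eq_analyticRank_of_analyticRank_le_one) (hmod : hasEntireLFunction_rat)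
    (hp2 : p ≠ 2) (C : VariableChange ℚ) (hC : C • V.quadraticTwist ((-1 : ℚ) ^ (p / 2) * p) = W)
    (hord : IsOrdinaryAt V p) (hred : ¬ V.HasIrreducibleModPGaloisRep p) (hadd : Addv W p)
    (hrV : V.analyticRank = 0) (hrW : W.analyticRank = 0)
    {N : ℕ} [NeZero N] {f : CuspForm (Gamma0 N) 2} (hf : IsNewformOf V f)
    (ϖ ϖ' : ℚ) (hϖ : (ϖ : ℝ) * V.realPeriodRat = plusPeriod f)
    (hϖ' : (ϖ' : ℝ) * V.imaginaryPeriodRat = minusPeriod f)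
    (hO : (∏ i ∈ ((Finset.range (p - 1)).erase 0).erase (p / 2),
        PowerSeries.constantCoeff
          (if Even i then padicLFunctionBranch f ((unitRoot V p : ℤ_[p]) : ℚ_[p]) i
            else padicLFunctionMinusBranch f ((unitRoot V p : ℤ_[p]) : ℚ_[p]) i)) ≠ 0)
    (hcert : (padicValNat p V.tamagawaProduct : ℤ) + padicValNat p W.tamagawaProduct +
        2 * padicValNat p (Nat.card (V.baseChange (CyclotomicField p ℚ)).toAffine.Point) +
        ((∏ i ∈ ((Finset.range (p - 1)).erase 0).erase (p / 2),
          PowerSeries.constantCoeff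
            (if Even i then padicLFunctionBranch f ((unitRoot V p : ℤ_[p]) : ℚ_[p]) i
              else padicLFunctionMinusBranch f ((unitRoot V p : ℤ_[p]) : ℚ_[p]) i)).valuation +
          ((p / 2 : ℕ) : ℤ) * (padicValRat p ϖ + padicValRat p ϖ') - padicValRat p ϖ -
          (if p % 4 = 1 then padicValRat p ϖ else padicValRat p ϖ')) ≤
        2 * (padicValNat p (Nat.card V.toAffine.Point) + padicValNat p (Nat.card W.toAffine.Point)) +
          padicValNat p (V.baseChange (CyclotomicField p ℚ)).tamagawaProduct)
    {qV : ℚ} (hqV : shaAn V = (qV : ℂ)) (hvV : padicValRat p qV ≤ 0) :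
    MissingUpperBoundAt W p := by
  obtain ⟨qV', qW, hqV', hqW, hle⟩ := X3GordCyclotomicPrime.exists_padicVal_shaOrder_add_le_of_facts
    p V W hW hGr hGZK hmod hp2 C hC hord hred hadd hrV hrW hf ϖ ϖ' hϖ hϖ' hO
  have hqq : qV' = qV := by exact_mod_cast hqV'.symm.trans hqV
  subst hqq
  have hV0 : (0 : ℤ) ≤ padicValNat p V.shaOrder := by positivity
  exact ⟨qW, hqW, by linarith⟩

end UpperHalf

end Summit.BirchSwinnertonDyer.Rank1Residual.Additive

end
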